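import Literature.MathematicalPhysics.QuantumFieldTheory.Balaban1983to89.Beta.HessianTelescopingKKT

/-!
# K0⁷ ∕ NODE O lens-2 «flow-gronwall-ttel» — ONE ORDER ABOVE `Beta/DressedMomentNormalisation`, PART A (scalar triple family): the decimated THIRD moment of the two-sided dressed kernel is transported
# EXACTLY (no aliasing remainder) under two-sided (L0∞)∕(L1∞) and (T0)∕(T1)∕(T2 = 0) — `Σ_z z_κ z_λ z_μ · N⁸·K_{ab}(N z) = N⁻¹ · M3_{κλμ}(T)_{ab}` in `d = 4`

Cell `pub-ymgap`, width seat `pub-ymgap-dag-n07-w3` (g18; N07 [B11] ∕ K0⁷–K1 junction; helper strictly BELOW the |β|-box stub of K0⁷ stmt-QuantumFields-20541).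
`--kind proof --supports stmt-QuantumFields-20541 --as helper`, COUNT-NEUTRAL.  NEW leaf; theorems only — 0 `def`, 0 `sorry`.  (Typed as a Literature/Beta sibling; homed under Theorems because
the gate keeps Literature∕ for PUBLISHED statements — this is [folklore] bookkeeping proved here.)

HONEST FRAMING (binding).  [folklore]
bookkeeping of absolutely convergent lattice sums over `ℝ`; NOTHING of the manuscripts under audit ([Balaban1987RG1] and companions) is asserted; no kernel of the record is touched.
Value = a kernel-checked identity that PRICES one channel of the NODE O cover's lens-2 «flow-gronwall-ttel» crux P-α (`Cruxes/Record13SepCoPHInhabited/Ideas/flow-gronwall-ttel.md`,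
CRIT-1 `…/CRIT-1-CUT1-lens2-flow-gronwall-ttel-v0.md` §2 S1 «odd moments: WardFree kills m₀, m₁, m₂, NOT m₃ … the generic rate on WardFree-as-typed is ρ = Lc⁻¹»; lens-2's own
«cheapest falsifier: the m₄ bookkeeping by hand∕in-tree one order above `hasSum_transport_m2Tensor` — does the identity carry an aliasing remainder?»).  ANSWER AT ORDER 3, PROVED:
NO aliasing remainder — for a Ward (T0)∕(T1) AND second-moment-free (T2 = 0) kernel `T`, dressed on BOTH sides by patterns reproducing constants and affine functions through `N•ℤ^d`
((L0∞)∕(L1∞) = Strang–Fix order 2, exactly what the tree proves for `wStep`: `constReproSum_wStep`, `linReproSum_wStep`), the `N•ℤ^d`-windowed THIRD moment of the dressed sum is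
`σ · m₃ · n₀` on the nose (all 26 other monomials of `(t + x − u)³` vanish FIBREWISE: the twenty with at most one `u` by the LEFT collapse against a vanishing `T`-moment, the six
with two `u`'s and the one with three by the RIGHT collapse — constants AND first moments of the right pattern — against `m₁ = 0` ∕ `m₀ = 0`).  Hence in `d = 4`, bond normalisation,
the by-value transport `K ↦ N⁸ · dressedEntry w K (N • ·)` maps the third-moment tensor to EXACTLY `N⁻¹` times itself on the Ward + m₂-free subspace: the `Lc⁻¹` channel of CRIT-1's
S1 is an exact eigen-relation (so lens-2's rate `ρ` can be `< Lc⁻¹` only on kernels with `M3 = 0`, e.g. under print's parity (5.8) on the DIAGONAL colour pairs — companion leaf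
`Thm/BalabanUVNodesK0TransportParity`), and aliasing through the Strang–Fix-2 weight can enter the moment jet only at order ≥ 4 (lens-2's toy: order 4, rate `1∕3` on even kernels).
P-α itself (a NORM contraction) is NOT touched; K0⁷ NOT closed; NODE O NOT inhabited; the Yang–Mills mass gap (Clay) is NOT proved by any of this.

WHAT IS PROVED (all [folklore], over `ℝ`; `χ = cosetInd N` in the applications):
* §1 cubic-weight summability: `summable_term_of_bound₃` (window bounded by `1`, weight `≤ B·(1+|u|₁³)(1+|t|₁³)(1+|x|₁³)`, factors with absolutely summable THIRD moments
  `Summable ((1 + |y|₁³)·|f y|)`), the monomial bounds of degree `≤ 3`, `absMoment₂_of_absMoment₃`, and `absMoment₃_of_decay510` (a (5.10)-shape decay gives it).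
* §2 `hasSum_term_rightW_of_zero` — the RIGHT collapse with an `x`-WEIGHT `r` reproduced through the window (`∀ a, Σ_x (χ(x−a)·r x) • w' x = ρ'`: (R0∞) for `r = 1`, (R1∞) for `r = x_i`)
  against a vanishing `T`-moment: the triple family sums to `0`.
* §3 `third_weight_expand` (the 27 monomials of `(t+x−u)_κ(t+x−u)_λ(t+x−u)_μ`) and ★ `hasSum_term_third_of_vanishing`: `Σ_{u,t,x} (χ(t+x−u)·(t+x−u)_κ(t+x−u)_λ(t+x−u)_μ) • (w u·T t·w' x)
  = σ · m₃ · n₀`.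
* §4 coarse ∕ decimated forms (`hasSum_coarse`, `hasSum_decimate_iff` of the sibling modules): `decimatedSum_third_moment_hasSum_lattice`.
* (PART B, sibling leaf `Thm/BalabanUVNodesK0TransportThirdMoment`: matrix kernels `dressedEntry`, the `d = 4` bond normalisation `N⁻¹·M3`, and the identity at `wStep Lc j` =
  lens-2's transport.)

Companion leaf: `Thm/BalabanUVNodesK0TransportParity` (the parity (5.8) is transport-stable; diagonal odd moments vanish).  Version v1 (2026-08-30, dag-n07-w3 g18).  Imports `Beta.HessianTelescopingKKT` (for `wStep` and its reproduction data; brings `DressedMomentNormalisation`, `DecimatedMomentSummable`,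
`DecimatedMomentLimit`).  No `sorry`, no `instance`, no `notation`, no new `def`.
-/

noncomputable section

namespace Summit.QuantumFields.YangMills.Theorems.K0TransportThirdMomentScalar

open Finset Filter Topology
open Literature.MathematicalPhysics.QuantumFieldTheory.Balaban1983to89
open Literature.MathematicalPhysics.QuantumFieldTheory.Balaban1983to89.Beta
open B12Sec2to5 (l1 l1_nonneg abs_coord_le_l1 Decay510 summable_exp_neg_l1)
open DecimatedMoment (cosetInd cosetInd_sub_comm)
open DecimatedMomentLimit (hasSum_decimate_iff abs_cosetInd_le_one)
open DecimatedMomentSummable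
open DressedMomentNormalisation
open HessianTelescopingKKT (wStep constReproSum_wStep linReproSum_wStep)

variable {d : ℕ}

/-! ## §1. Cubic-weight summability -/

/-- `|y|₁ ≤ 1 + |y|₁³`. [folklore] -/
private theorem l1_le_one_add_cube (y : Fin d → ℤ) : l1 y ≤ 1 + l1 y ^ 3 := by
  have h := l1_nonneg y
  nlinarith [sq_nonneg (l1 y - 1), sq_nonneg (l1 y), mul_nonneg h (sq_nonneg (l1 y - 1))]

/-- `|y|₁² ≤ 1 + |y|₁³`. [folklore] -/
private theorem l1_sq_le_one_add_cube (y : Fin d → ℤ) : l1 y ^ 2 ≤ 1 + l1 y ^ 3 := by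
  have h := l1_nonneg y
  nlinarith [sq_nonneg (l1 y - 1), sq_nonneg (l1 y), mul_nonneg h (sq_nonneg (l1 y - 1))]

/-- Degree 0: `|1| ≤ 1 + |y|₁³`. [folklore] -/
theorem abs_one_le_cube (y : Fin d → ℤ) : |(((fun _ => (1 : ℤ)) : (Fin d → ℤ) → ℤ) y : ℝ)| ≤ 1 + l1 y ^ 3 := by
  rw [Int.cast_one, abs_one]
  have := l1_nonneg y
  nlinarith [pow_nonneg this 3]

/-- Degree 1: `|y_i| ≤ 1 + |y|₁³`. [folklore] -/
theorem abs_coord_le_cube (i : Fin d) (y : Fin d → ℤ) : |((y i : ℤ) : ℝ)| ≤ 1 + l1 y ^ 3 :=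
  (abs_coord_le_l1 y i).trans (l1_le_one_add_cube y)

/-- Degree 2: `|y_i y_j| ≤ 1 + |y|₁³`. [folklore] -/
theorem abs_coord2_le_cube (i j : Fin d) (y : Fin d → ℤ) : |((y i * y j : ℤ) : ℝ)| ≤ 1 + l1 y ^ 3 := by
  rw [Int.cast_mul, abs_mul]
  have hm : |(y i : ℝ)| * |(y j : ℝ)| ≤ l1 y * l1 y :=
    mul_le_mul (abs_coord_le_l1 y i) (abs_coord_le_l1 y j) (abs_nonneg _) (l1_nonneg y)
  have h2 := l1_sq_le_one_add_cube y
  nlinarith [hm, h2]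

/-- Degree 3: `|y_i y_j y_k| ≤ 1 + |y|₁³`. [folklore] -/
theorem abs_coord3_le_cube (i j k : Fin d) (y : Fin d → ℤ) : |((y i * y j * y k : ℤ) : ℝ)| ≤ 1 + l1 y ^ 3 := by
  rw [Int.cast_mul, Int.cast_mul, abs_mul, abs_mul]
  have h1 := abs_coord_le_l1 y i
  have h2 := abs_coord_le_l1 y j
  have h3 := abs_coord_le_l1 y k
  have hm : |(y i : ℝ)| * |(y j : ℝ)| * |(y k : ℝ)| ≤ l1 y * l1 y * l1 y :=
    mul_le_mul (mul_le_mul h1 h2 (abs_nonneg _) (l1_nonneg y)) h3 (abs_nonneg _) (mul_nonneg (l1_nonneg y) (l1_nonneg y))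
  nlinarith [hm, pow_nonneg (l1_nonneg y) 3]

/-- **ENGINE (cubic weights).**  Window bounded by `1`, weight of at most cubic growth in each variable separately, three factors with absolutely summable THIRD moments: the triple
family is summable on `ℤ^d × ℤ^d × ℤ^d`. [folklore] -/
theorem summable_term_of_bound₃ {χ : (Fin d → ℤ) → ℤ} (hχ : ∀ z, |(χ z : ℝ)| ≤ 1) {w T w' : (Fin d → ℤ) → ℝ}
    (hw : Summable (fun y => (1 + l1 y ^ 3) * |w y|)) (hT : Summable (fun y => (1 + l1 y ^ 3) * |T y|))
    (hw' : Summable (fun y => (1 + l1 y ^ 3) * |w' y|))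
    {g : (Fin d → ℤ) → (Fin d → ℤ) → (Fin d → ℤ) → ℤ} {B : ℝ}
    (hg : ∀ u t x, |(g u t x : ℝ)| ≤ B * ((1 + l1 u ^ 3) * ((1 + l1 t ^ 3) * (1 + l1 x ^ 3)))) :
    Summable (term χ w T w' g) := by
  have hnn : ∀ f : (Fin d → ℤ) → ℝ, 0 ≤ fun y => (1 + l1 y ^ 3) * |f y| :=
    fun f y => mul_nonneg (by have := l1_nonneg y; positivity) (abs_nonneg _)
  have hM : Summable (fun q : (Fin d → ℤ) × (Fin d → ℤ) × (Fin d → ℤ) =>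
      B * (((1 + l1 q.1 ^ 3) * |w q.1|) * (((1 + l1 q.2.1 ^ 3) * |T q.2.1|) * ((1 + l1 q.2.2 ^ 3) * |w' q.2.2|)))) :=
    (hw.mul_of_nonneg (hT.mul_of_nonneg hw' (hnn T) (hnn w')) (hnn w)
      (fun _ => mul_nonneg (hnn T _) (hnn w' _))).mul_left B
  refine Summable.of_norm_bounded hM (fun q => ?_)
  obtain ⟨u, t, x⟩ := q
  rw [Real.norm_eq_abs, term_apply, zsmul_eq_mul, Int.cast_mul, abs_mul, abs_mul, abs_mul, abs_mul]
  have hpos : 0 ≤ (1 + l1 u ^ 3) * ((1 + l1 t ^ 3) * (1 + l1 x ^ 3)) := by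
    have := l1_nonneg u; have := l1_nonneg t; have := l1_nonneg x; positivity
  have h1 : |(χ (t + x - u) : ℝ)| * |(g u t x : ℝ)| ≤ 1 * (B * ((1 + l1 u ^ 3) * ((1 + l1 t ^ 3) * (1 + l1 x ^ 3)))) :=
    mul_le_mul (hχ _) (hg u t x) (abs_nonneg _) zero_le_one
  calc |(χ (t + x - u) : ℝ)| * |(g u t x : ℝ)| * (|w u| * |T t| * |w' x|)
      ≤ 1 * (B * ((1 + l1 u ^ 3) * ((1 + l1 t ^ 3) * (1 + l1 x ^ 3)))) * (|w u| * |T t| * |w' x|) :=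
        mul_le_mul_of_nonneg_right h1 (by positivity)
    _ = B * (((1 + l1 u ^ 3) * |w u|) * (((1 + l1 t ^ 3) * |T t|) * ((1 + l1 x ^ 3) * |w' x|))) := by ring

/-- Summability of a MONOMIAL family from three letter bounds of degree `≤ 3`. [folklore] -/
theorem summable_term_mono₃ {χ : (Fin d → ℤ) → ℤ} (hχ : ∀ z, |(χ z : ℝ)| ≤ 1) {w T w' : (Fin d → ℤ) → ℝ}
    (hw : Summable (fun y => (1 + l1 y ^ 3) * |w y|)) (hT : Summable (fun y => (1 + l1 y ^ 3) * |T y|))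
    (hw' : Summable (fun y => (1 + l1 y ^ 3) * |w' y|)) {p q r : (Fin d → ℤ) → ℤ}
    (hp : ∀ y, |(p y : ℝ)| ≤ 1 + l1 y ^ 3) (hq : ∀ y, |(q y : ℝ)| ≤ 1 + l1 y ^ 3) (hr : ∀ y, |(r y : ℝ)| ≤ 1 + l1 y ^ 3) :
    Summable (term χ w T w' (mono p q r)) := by
  refine summable_term_of_bound₃ hχ hw hT hw' (B := 1) (fun u t x => ?_)
  rw [one_mul]
  simp only [mono, Int.cast_mul, abs_mul]
  have := l1_nonneg u; have := l1_nonneg t; have := l1_nonneg x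
  exact mul_le_mul (hp u) (mul_le_mul (hq t) (hr x) (abs_nonneg _) (by positivity)) (by positivity) (by positivity)

/-- Absolutely summable third moments give absolutely summable second moments. [folklore] -/
theorem absMoment₂_of_absMoment₃ {f : (Fin d → ℤ) → ℝ} (hf : Summable (fun y => (1 + l1 y ^ 3) * |f y|)) : AbsMoment₂ f := by
  refine Summable.of_nonneg_of_le (fun y => mul_nonneg (by positivity) (abs_nonneg _)) (fun y => ?_) (hf.mul_left 2)
  have h := l1_sq_le_one_add_cube y
  have ha := abs_nonneg (f y)
  nlinarith [h, ha, pow_nonneg (l1_nonneg y) 3]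

/-- `s³·e^{−δs} ≤ (48/δ³)·e^{−(δ/2)s}` for `s ≥ 0`, `δ > 0` (from `x³/3! ≤ eˣ` at `x = δs/2`). [folklore] -/
private theorem cube_mul_exp_neg_le {δ s : ℝ} (hδ : 0 < δ) (hs : 0 ≤ s) :
    s ^ 3 * Real.exp (-δ * s) ≤ 48 / δ ^ 3 * Real.exp (-(δ / 2) * s) := by
  have hx : 0 ≤ δ * s / 2 := by positivity
  have h := Real.pow_div_factorial_le_exp _ hx 3
  have h3 : ((3 : ℕ).factorial : ℝ) = 6 := by norm_num [Nat.factorial]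
  rw [h3] at h
  have hδ3 : 0 < δ ^ 3 := pow_pos hδ 3
  -- s³ ≤ (48/δ³)·exp(δ s/2)
  have hs3 : s ^ 3 ≤ 48 / δ ^ 3 * Real.exp (δ * s / 2) := by
    rw [div_mul_eq_mul_div, le_div_iff₀ hδ3]
    have : (δ * s / 2) ^ 3 / 6 = δ ^ 3 * s ^ 3 / 48 := by ring
    rw [this] at h
    linarith
  have hexp : Real.exp (-δ * s) = Real.exp (-(δ / 2) * s) * Real.exp (-(δ * s / 2)) := by
    rw [← Real.exp_add]; ring_nf
  calc s ^ 3 * Real.exp (-δ * s) ≤ 48 / δ ^ 3 * Real.exp (δ * s / 2) * Real.exp (-δ * s) :=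
        mul_le_mul_of_nonneg_right hs3 (Real.exp_pos _).le
    _ = 48 / δ ^ 3 * Real.exp (-(δ / 2) * s) := by
        rw [hexp, mul_assoc, ← mul_assoc (Real.exp (δ * s / 2)), mul_comm (Real.exp (δ * s / 2)), mul_assoc, ← Real.exp_add]
        simp

/-- A (5.10)-shape decay gives an absolutely summable THIRD moment. [folklore] -/
theorem absMoment₃_of_decay510 {f : (Fin d → ℤ) → ℝ} {C δ₁ : ℝ} (hδ : 0 < δ₁) (h : Decay510 f C δ₁) :
    Summable (fun y => (1 + l1 y ^ 3) * |f y|) := by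
  have hC : 0 ≤ C := by
    have h0 := h 0
    have : l1 (0 : Fin d → ℤ) = 0 := by simp [l1]
    rw [this, mul_zero, Real.exp_zero, mul_one] at h0
    exact (abs_nonneg _).trans h0
  have hmaj : Summable (fun y : Fin d → ℤ => C * ((1 + 48 / δ₁ ^ 3) * Real.exp (-(δ₁ / 2) * l1 y))) :=
    ((summable_exp_neg_l1 (half_pos hδ) d).mul_left (1 + 48 / δ₁ ^ 3)).mul_left C
  refine Summable.of_nonneg_of_le (fun y => mul_nonneg (by have := l1_nonneg y; positivity) (abs_nonneg _)) (fun y => ?_) hmaj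
  have hy := l1_nonneg y
  have hfy := h y
  have hcube := cube_mul_exp_neg_le hδ hy
  have hmono : Real.exp (-δ₁ * l1 y) ≤ Real.exp (-(δ₁ / 2) * l1 y) := Real.exp_le_exp.mpr (by nlinarith)
  calc (1 + l1 y ^ 3) * |f y| ≤ (1 + l1 y ^ 3) * (C * Real.exp (-δ₁ * l1 y)) :=
        mul_le_mul_of_nonneg_left hfy (by positivity)
    _ = C * (Real.exp (-δ₁ * l1 y) + l1 y ^ 3 * Real.exp (-δ₁ * l1 y)) := by ring
    _ ≤ C * (Real.exp (-(δ₁ / 2) * l1 y) + 48 / δ₁ ^ 3 * Real.exp (-(δ₁ / 2) * l1 y)) := by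
        gcongr
    _ = C * ((1 + 48 / δ₁ ^ 3) * Real.exp (-(δ₁ / 2) * l1 y)) := by ring

/-! ## §2. The RIGHT collapse with an `x`-weight reproduced through the window, against a vanishing `T`-moment -/

section Collapse

variable (χ : (Fin d → ℤ) → ℤ) (w T w' : (Fin d → ℤ) → ℝ)

/-- **RIGHT COLLAPSE WITH AN `x`-WEIGHT, VANISHING CASE.**  Weight `p u · (q t · r x)`; hypothesis: for every `a` the window family `x ↦ (χ(x−a) · r x) • w' x` has the sum `ρ'`
((R0∞): `r = 1`; (R1∞): `r = x_i`, the window being even); if `Σ q • T = 0` and the triple family is summable, it has the sum `0` — fibre over `(u, t)` (inner `x`, the hypothesis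
at `a = u − t`), then over `u` (inner `t`, the vanishing moment).  No hypothesis on the `w`-family. [folklore] -/
theorem hasSum_term_rightW_of_zero {ρ' : ℝ} (r : (Fin d → ℤ) → ℤ) (hR : ∀ a, HasSum (fun x => (χ (x - a) * r x) • w' x) ρ')
    (p q : (Fin d → ℤ) → ℤ) (hq : HasSum (fun t => q t • T t) 0) (hS : Summable (term χ w T w' (mono p q r))) :
    HasSum (term χ w T w' (mono p q r)) 0 := by
  set f := term χ w T w' (mono p q r) with hf
  have hF : HasSum (f ∘ ⇑(Equiv.prodAssoc (Fin d → ℤ) (Fin d → ℤ) (Fin d → ℤ))) (∑' s, f s) :=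
    (Equiv.hasSum_iff _).mpr hS.hasSum
  have hfib : ∀ m : (Fin d → ℤ) × (Fin d → ℤ),
      HasSum (fun x => (f ∘ ⇑(Equiv.prodAssoc (Fin d → ℤ) (Fin d → ℤ) (Fin d → ℤ))) (m, x))
        (((p m.1 : ℤ) : ℝ) * w m.1 * (((q m.2 : ℤ) : ℝ) * T m.2) * ρ') := by
    intro m
    have h := (hR (m.1 - m.2)).mul_left (((p m.1 : ℤ) : ℝ) * w m.1 * (((q m.2 : ℤ) : ℝ) * T m.2))
    refine h.congr_fun (fun x => ?_)
    simp only [Function.comp_apply, Equiv.prodAssoc_apply, hf, term, mono, zsmul_eq_mul, Int.cast_mul]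
    rw [show m.2 + x - m.1 = x - (m.1 - m.2) by abel]
    ring
  have hG := hF.prod_fiberwise hfib
  -- fibre once more over `u`, inner index `t`: the `t`-family is `(p u · w u) · (Σ q • T = 0) · ρ'`
  have hq' : HasSum (fun t => ((q t : ℤ) : ℝ) * T t) 0 := by
    simpa only [zsmul_eq_mul] using hq
  have hfib2 : ∀ u : Fin d → ℤ, HasSum (fun t => ((p u : ℤ) : ℝ) * w u * (((q t : ℤ) : ℝ) * T t) * ρ') 0 := by
    intro u
    have h := (hq'.mul_left (((p u : ℤ) : ℝ) * w u)).mul_right ρ'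
    simpa only [mul_zero, zero_mul] using h
  have h0 : HasSum (fun _ : Fin d → ℤ => (0 : ℝ)) (∑' s, f s) := hG.prod_fiberwise hfib2
  exact h0.unique hasSum_zero ▸ hS.hasSum

end Collapse

/-! ## §3. The 27 monomials of the cubic weight and THE IDENTITY: the windowed THIRD moment of the two-sided dressed sum is `σ · m₃ · n₀` -/

section Master

variable (χ : (Fin d → ℤ) → ℤ) (w T w' : (Fin d → ℤ) → ℝ)

/-- The 27-monomial expansion of `(t+x−u)_κ (t+x−u)_λ (t+x−u)_μ` (eight with no `u`, twelve with one, six with two, one with three). [folklore] -/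
theorem third_weight_expand (κ lam μ : Fin d) :
    (fun u t x : Fin d → ℤ => (t + x - u) κ * (t + x - u) lam * (t + x - u) μ)
      = mono (fun _ => 1) (fun t => t κ * t lam * t μ) (fun _ => 1)
        + mono (fun _ => 1) (fun t => t κ * t lam) (fun x => x μ)
        + mono (fun _ => 1) (fun t => t κ * t μ) (fun x => x lam)
        + mono (fun _ => 1) (fun t => t lam * t μ) (fun x => x κ)
        + mono (fun _ => 1) (fun t => t κ) (fun x => x lam * x μ)
        + mono (fun _ => 1) (fun t => t lam) (fun x => x κ * x μ)
        + mono (fun _ => 1) (fun t => t μ) (fun x => x κ * x lam)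
        + mono (fun _ => 1) (fun _ => 1) (fun x => x κ * x lam * x μ)
        - mono (fun u => u κ) (fun t => t lam * t μ) (fun _ => 1)
        - mono (fun u => u lam) (fun t => t κ * t μ) (fun _ => 1)
        - mono (fun u => u μ) (fun t => t κ * t lam) (fun _ => 1)
        - mono (fun u => u κ) (fun t => t lam) (fun x => x μ)
        - mono (fun u => u κ) (fun t => t μ) (fun x => x lam)
        - mono (fun u => u lam) (fun t => t κ) (fun x => x μ)
        - mono (fun u => u lam) (fun t => t μ) (fun x => x κ)
        - mono (fun u => u μ) (fun t => t κ) (fun x => x lam)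
        - mono (fun u => u μ) (fun t => t lam) (fun x => x κ)
        - mono (fun u => u κ) (fun _ => 1) (fun x => x lam * x μ)
        - mono (fun u => u lam) (fun _ => 1) (fun x => x κ * x μ)
        - mono (fun u => u μ) (fun _ => 1) (fun x => x κ * x lam)
        + mono (fun u => u κ * u lam) (fun t => t μ) (fun _ => 1)
        + mono (fun u => u κ * u μ) (fun t => t lam) (fun _ => 1)
        + mono (fun u => u lam * u μ) (fun t => t κ) (fun _ => 1)
        + mono (fun u => u κ * u lam) (fun _ => 1) (fun x => x μ)
        + mono (fun u => u κ * u μ) (fun _ => 1) (fun x => x lam)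
        + mono (fun u => u lam * u μ) (fun _ => 1) (fun x => x κ)
        - mono (fun u => u κ * u lam * u μ) (fun _ => 1) (fun _ => 1) := by
  funext u t x
  simp only [Pi.add_apply, Pi.sub_apply, mono]
  ring

/-- **★ THE IDENTITY under two-sided (L0∞)∕(L1∞)∕(R0∞)∕(R1∞) and (T0)∕(T1)∕(T2 = 0)**: with `Σ T = 0`, `Σ t_i • T = 0`, `Σ (t_i t_j) • T = 0` (all `i, j`), `Σ (t_κ t_λ t_μ) • T = m₃`,
`Σ w' = n₀`, the window families of `w` reproducing `1` (mass `σ`) and `u_i` (constants `C i`), those of `w'` reproducing `1` (`σ'`) and `x_i` (`C' i`), and the three factors with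
absolutely summable third moments: the `χ`-windowed THIRD moment of the two-sided dressed sum over ALL of `ℤ^d × ℤ^d × ℤ^d` is `σ · m₃ · n₀` — NO aliasing remainder.  Twenty-six of the
twenty-seven monomial families sum to `0` FIBREWISE (left collapse against `m₂ = m₁ = m₀ = 0` for the twenty with at most one `u`; right collapse — constants AND first moments of
`w'` — against `m₁ = 0` ∕ `m₀ = 0` for the seven with two or three `u`'s), so no second or third moment of `w` or `w'` enters. [folklore] -/
theorem hasSum_term_third_of_vanishing {χ : (Fin d → ℤ) → ℤ} (hχ : ∀ z, |(χ z : ℝ)| ≤ 1) {w T w' : (Fin d → ℤ) → ℝ}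
    {σ σ' : ℝ} {C C' : Fin d → ℝ}
    (hL0 : ∀ a, HasSum (fun u => χ (a - u) • w u) σ) (hL1 : ∀ a i, HasSum (fun u => (χ (a - u) * u i) • w u) (C i))
    (hR0 : ∀ a, HasSum (fun x => χ (x - a) • w' x) σ') (hR1 : ∀ a i, HasSum (fun x => (χ (x - a) * x i) • w' x) (C' i))
    (κ lam μ : Fin d) {m₃ n₀ : ℝ}
    (hT0 : HasSum T 0) (hT1 : ∀ i, HasSum (fun t => t i • T t) 0) (hT2 : ∀ i j, HasSum (fun t => (t i * t j) • T t) 0)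
    (h3 : HasSum (fun t => (t κ * t lam * t μ) • T t) m₃) (hn0 : HasSum w' n₀)
    (hw : Summable (fun y => (1 + l1 y ^ 3) * |w y|)) (hT : Summable (fun y => (1 + l1 y ^ 3) * |T y|))
    (hw' : Summable (fun y => (1 + l1 y ^ 3) * |w' y|)) :
    HasSum (term χ w T w' (fun u t x => (t + x - u) κ * (t + x - u) lam * (t + x - u) μ)) (σ * m₃ * n₀) := by
  have hW := hasSum_window_one χ w hL0
  have h0' : HasSum (fun t => (fun _ => (1 : ℤ)) t • T t) 0 := hasSum_one_smul hT0
  have hR0' : ∀ a, HasSum (fun x => (χ (x - a) * (fun _ => (1 : ℤ)) x) • w' x) σ' := fun a => by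
    simpa only [mul_one] using hR0 a
  -- summability of each monomial family, from the cubic engine
  have hS : ∀ {p q r : (Fin d → ℤ) → ℤ}, (∀ y, |(p y : ℝ)| ≤ 1 + l1 y ^ 3) → (∀ y, |(q y : ℝ)| ≤ 1 + l1 y ^ 3) →
      (∀ y, |(r y : ℝ)| ≤ 1 + l1 y ^ 3) → Summable (term χ w T w' (mono p q r)) :=
    fun hp hq hr => summable_term_mono₃ hχ hw hT hw' hp hq hr
  have b0 : ∀ y : Fin d → ℤ, |(((fun _ => (1 : ℤ)) : (Fin d → ℤ) → ℤ) y : ℝ)| ≤ 1 + l1 y ^ 3 := abs_one_le_cube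
  have b1 : ∀ (i : Fin d) (y : Fin d → ℤ), |(((fun y => y i) : (Fin d → ℤ) → ℤ) y : ℝ)| ≤ 1 + l1 y ^ 3 := fun i y => abs_coord_le_cube i y
  have b2 : ∀ (i j : Fin d) (y : Fin d → ℤ), |(((fun y => y i * y j) : (Fin d → ℤ) → ℤ) y : ℝ)| ≤ 1 + l1 y ^ 3 :=
    fun i j y => abs_coord2_le_cube i j y
  have b3 : ∀ (i j k : Fin d) (y : Fin d → ℤ), |(((fun y => y i * y j * y k) : (Fin d → ℤ) → ℤ) y : ℝ)| ≤ 1 + l1 y ^ 3 :=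
    fun i j k y => abs_coord3_le_cube i j k y
  rw [third_weight_expand]
  simp only [term_add, term_sub]
  simp only [Pi.add_def, Pi.sub_def]
  have h := ((((((((((((((((((((((((((
    -- [TTT] the surviving term
    hasSum_term_left χ w T w' _ hW _ _ h3 (hasSum_one_smul hn0) (hS b0 (b3 κ lam μ) b0)).add
    -- [TTX] [TXT] [XTT]
    (hasSum_term_left_of_zero χ w T w' _ hW _ (fun x => x μ) (hT2 κ lam) (hS b0 (b2 κ lam) (b1 μ)))).add
    (hasSum_term_left_of_zero χ w T w' _ hW _ (fun x => x lam) (hT2 κ μ) (hS b0 (b2 κ μ) (b1 lam)))).add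
    (hasSum_term_left_of_zero χ w T w' _ hW _ (fun x => x κ) (hT2 lam μ) (hS b0 (b2 lam μ) (b1 κ)))).add
    -- [TXX] [XTX] [XXT]
    (hasSum_term_left_of_zero χ w T w' _ hW _ (fun x => x lam * x μ) (hT1 κ) (hS b0 (b1 κ) (b2 lam μ)))).add
    (hasSum_term_left_of_zero χ w T w' _ hW _ (fun x => x κ * x μ) (hT1 lam) (hS b0 (b1 lam) (b2 κ μ)))).add
    (hasSum_term_left_of_zero χ w T w' _ hW _ (fun x => x κ * x lam) (hT1 μ) (hS b0 (b1 μ) (b2 κ lam)))).add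
    -- [XXX]
    (hasSum_term_left_of_zero χ w T w' _ hW _ (fun x => x κ * x lam * x μ) h0' (hS b0 b0 (b3 κ lam μ)))).sub
    -- [UTT] [TUT] [TTU]
    (hasSum_term_left_of_zero χ w T w' _ (fun a => hL1 a κ) _ (fun _ => 1) (hT2 lam μ) (hS (b1 κ) (b2 lam μ) b0))).sub
    (hasSum_term_left_of_zero χ w T w' _ (fun a => hL1 a lam) _ (fun _ => 1) (hT2 κ μ) (hS (b1 lam) (b2 κ μ) b0))).sub
    (hasSum_term_left_of_zero χ w T w' _ (fun a => hL1 a μ) _ (fun _ => 1) (hT2 κ lam) (hS (b1 μ) (b2 κ lam) b0))).sub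
    -- [UTX] [UXT] [TUX] [XUT] [TXU] [XTU]
    (hasSum_term_left_of_zero χ w T w' _ (fun a => hL1 a κ) _ (fun x => x μ) (hT1 lam) (hS (b1 κ) (b1 lam) (b1 μ)))).sub
    (hasSum_term_left_of_zero χ w T w' _ (fun a => hL1 a κ) _ (fun x => x lam) (hT1 μ) (hS (b1 κ) (b1 μ) (b1 lam)))).sub
    (hasSum_term_left_of_zero χ w T w' _ (fun a => hL1 a lam) _ (fun x => x μ) (hT1 κ) (hS (b1 lam) (b1 κ) (b1 μ)))).sub
    (hasSum_term_left_of_zero χ w T w' _ (fun a => hL1 a lam) _ (fun x => x κ) (hT1 μ) (hS (b1 lam) (b1 μ) (b1 κ)))).sub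
    (hasSum_term_left_of_zero χ w T w' _ (fun a => hL1 a μ) _ (fun x => x lam) (hT1 κ) (hS (b1 μ) (b1 κ) (b1 lam)))).sub
    (hasSum_term_left_of_zero χ w T w' _ (fun a => hL1 a μ) _ (fun x => x κ) (hT1 lam) (hS (b1 μ) (b1 lam) (b1 κ)))).sub
    -- [UXX] [XUX] [XXU]
    (hasSum_term_left_of_zero χ w T w' _ (fun a => hL1 a κ) _ (fun x => x lam * x μ) h0' (hS (b1 κ) b0 (b2 lam μ)))).sub
    (hasSum_term_left_of_zero χ w T w' _ (fun a => hL1 a lam) _ (fun x => x κ * x μ) h0' (hS (b1 lam) b0 (b2 κ μ)))).sub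
    (hasSum_term_left_of_zero χ w T w' _ (fun a => hL1 a μ) _ (fun x => x κ * x lam) h0' (hS (b1 μ) b0 (b2 κ lam)))).add
    -- [UUT] [UTU] [TUU] : right collapse (R0∞) against m₁ = 0
    (hasSum_term_rightW_of_zero χ w T w' (fun _ => 1) hR0' (fun u => u κ * u lam) (fun t => t μ) (hT1 μ) (hS (b2 κ lam) (b1 μ) b0))).add
    (hasSum_term_rightW_of_zero χ w T w' (fun _ => 1) hR0' (fun u => u κ * u μ) (fun t => t lam) (hT1 lam) (hS (b2 κ μ) (b1 lam) b0))).add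
    (hasSum_term_rightW_of_zero χ w T w' (fun _ => 1) hR0' (fun u => u lam * u μ) (fun t => t κ) (hT1 κ) (hS (b2 lam μ) (b1 κ) b0))).add
    -- [UUX] [UXU] [XUU] : right collapse (R1∞) against m₀ = 0
    (hasSum_term_rightW_of_zero χ w T w' (fun x => x μ) (fun a => hR1 a μ) (fun u => u κ * u lam) (fun _ => 1) h0' (hS (b2 κ lam) b0 (b1 μ)))).add
    (hasSum_term_rightW_of_zero χ w T w' (fun x => x lam) (fun a => hR1 a lam) (fun u => u κ * u μ) (fun _ => 1) h0' (hS (b2 κ μ) b0 (b1 lam)))).add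
    (hasSum_term_rightW_of_zero χ w T w' (fun x => x κ) (fun a => hR1 a κ) (fun u => u lam * u μ) (fun _ => 1) h0' (hS (b2 lam μ) b0 (b1 κ)))).sub
    -- [UUU] : right collapse (R0∞) against m₀ = 0
    (hasSum_term_rightW_of_zero χ w T w' (fun _ => 1) hR0' (fun u => u κ * u lam * u μ) (fun _ => 1) h0' (hS (b3 κ lam μ) b0 b0))
  simpa only [add_zero, sub_zero] using h

end Master

/-! ## §4. Coarse-point and decimated-lattice forms (`χ = cosetInd N`) -/

section Lattice

/-- `(N•z)_κ (N•z)_λ (N•z)_μ = N³ · z_κ z_λ z_μ`. [folklore] -/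
theorem weight_zsmul₃ (N : ℕ) (z : Fin d → ℤ) (κ lam μ : Fin d) :
    ((N : ℤ) • z) κ * ((N : ℤ) • z) lam * ((N : ℤ) • z) μ = (N : ℤ) ^ 3 * (z κ * z lam * z μ) := by
  simp only [Pi.smul_apply, smul_eq_mul]
  ring

/-- **THE IDENTITY ON THE COARSE LATTICE** (`N ≠ 0`): under the hypotheses of `hasSum_term_third_of_vanishing` with `χ = cosetInd N` in the `ConstReproSum`∕`LinReproSum` form for
BOTH patterns, the THIRD moment of the decimated dressed kernel `z ↦ dressedSum w T w' (N • z)` with the weight `N³ · z_κ z_λ z_μ` is `σ · m₃ · n₀`. [folklore] -/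
theorem decimatedSum_third_moment_hasSum_lattice {N : ℕ} (hN : N ≠ 0) (w T w' : (Fin d → ℤ) → ℝ) {σ σ' : ℝ} {C C' : Fin d → ℝ}
    (hw : ConstReproSum N w σ) (hwl : LinReproSum N w C) (hR : ConstReproSum N w' σ') (hRl : LinReproSum N w' C')
    (κ lam μ : Fin d) {m₃ n₀ : ℝ}
    (hT0 : HasSum T 0) (hT1 : ∀ i, HasSum (fun t => t i • T t) 0) (hT2 : ∀ i j, HasSum (fun t => (t i * t j) • T t) 0)
    (h3 : HasSum (fun t => (t κ * t lam * t μ) • T t) m₃) (hn0 : HasSum w' n₀)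
    (hw3 : Summable (fun y => (1 + l1 y ^ 3) * |w y|)) (hT3 : Summable (fun y => (1 + l1 y ^ 3) * |T y|))
    (hw'3 : Summable (fun y => (1 + l1 y ^ 3) * |w' y|)) :
    HasSum (fun z : Fin d → ℤ => ((N : ℤ) ^ 3 * (z κ * z lam * z μ)) • dressedSum w T w' ((N : ℤ) • z)) (σ * m₃ * n₀) := by
  have hR0 : ∀ a, HasSum (fun x => cosetInd N (x - a) • w' x) σ' := (constReproSum_iff_right N w' σ').1 hR
  have hR1 : ∀ a i, HasSum (fun x => (cosetInd N (x - a) * x i) • w' x) (C' i) := fun a i => by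
    have h := hRl a i
    refine h.congr_fun fun x => ?_
    rw [cosetInd_sub_comm]
  have hmain := hasSum_term_third_of_vanishing (abs_cosetInd_le_one N) hw hwl hR0 hR1 κ lam μ hT0 hT1 hT2 h3 hn0 hw3 hT3 hw'3
  have hK : ∀ y, Summable (fun p : (Fin d → ℤ) × (Fin d → ℤ) => w p.1 * T (y + p.1 - p.2) * w' p.2) :=
    fun y => summable_dressed_fibre (absMoment₂_of_absMoment₃ hw3) (absMoment₂_of_absMoment₃ hT3) (absMoment₂_of_absMoment₃ hw'3) y
  have hcoarse := hasSum_coarse (cosetInd N) w T w' (fun y => y κ * y lam * y μ) hmain hK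
  have h := (hasSum_decimate_iff hN (fun y => y κ * y lam * y μ) (dressedSum w T w') _).2 hcoarse
  refine h.congr_fun (fun z => ?_)
  simp only [weight_zsmul₃]

end Lattice

end Summit.QuantumFields.YangMills.Theorems.K0TransportThirdMomentScalar

end
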